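import Summits.KontsevichZagierPeriods.Zeta5Search.CatalanRecordExponent
import Literature.NumberTheory.Irrationality.Zudilin2003.CatalanRemarksTheorem1
import HarnessLib

/-!
# ζ(5) search, Catalan arm — the record exponent `0.5242…` for `G` is now TREE-CERTIFIED UNCONDITIONALLY

Cell `pub-zeta5` (lit/lead seat, generation 6, 2026-08-20).
HONEST FRAMING: systematic search; no irrationality claim unless certified.  An effective exponent `< 1` never
bears on irrationality; `G` is not known to be irrational.

`CatalanRecordExponent.record_of_krTheorems` realised the printed record exponent `0.5242…` of [Nesterenko2016] by
Zudilin's 2003 sequence MODULO the cited integrality `Zudilin2003.krTheorems` ([KrattenthalerRivoal2008Catalan],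
`2^{4n+2}d_{2n}²v_n ∈ ℤ`, a named fact).  With Theorem 1 of [Zudilin2002CatalanRemarks] now PROVED in the tree
(`Zudilin2003.remarksTheorem1_holds`, file `Literature/…/Zudilin2003/CatalanRemarksTheorem1.lean`: `2^{4n+e(n)}u_n ∈ ℤ`,
`2^{4n+e(n)}D²_{2n−1}v_n ∈ ℤ`, `e(n) = o(n)`), the denominators `Q_n = 2^{4n+e(n)}D²_{2n−1}u_n` have the SAME exponential
type `4 log 2 + 4 + log((1+√5)/2)⁵ = 9.17864…` (`remarksTheorem1.tendsto_log_denom` + `tendsto_log_u_div`), so the record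
exponent follows with NO hypothesis:

* `record_unconditional` — integer sequences `P_n, Q_n` (`Q_n = 2^{4n+e(n)}D²_{2n−1}u_n`, `P_n = 2^{4n+e(n)}D²_{2n−1}v_n`)
  with `log Q_n / n → 9.17864…` and, eventually, `0 < |G − P_n/Q_n| < |Q_n|^{−0.5242}`.

(Exact exponent `2·2.40606/9.17865 = 0.524273…`; the enclosures are those of `CatalanRecordExponent`.)
-/

noncomputable section

open Filter Real
open scoped Topology

namespace Summit.KontsevichZagierPeriods.Zeta5Search

namespace CatalanRecord

open Literature.NumberTheory.Irrationality.Zudilin2003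
open Literature.NumberTheory.Transcendental (catalanConstant)
open Zudilin2003Growth (uR vR uR_pos tendsto_log_u_div tendsto_log_abs_sub_catalan_div form_ne_zero)

/-- **The record exponent `0.5242…` for Catalan's constant, realised by Zudilin's 2003 sequence — UNCONDITIONAL.**
There are an exponent sequence `e` and integer sequences `P_n, Q_n` with `Q_n = 2^{4n+e(n)} D_{2n−1}² u_n`,
`P_n = 2^{4n+e(n)} D_{2n−1}² v_n` for all `n`, `log Q_n / n → 4 log 2 + 4 + log((1+√5)/2)⁵`, and, eventually,
`0 < |G − P_n/Q_n| < |Q_n|^{−0.5242}`.  Inputs: `Zudilin2003.remarksTheorem1_holds` (denominators, PROVED),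
`tendsto_log_u_div`, `tendsto_log_abs_sub_catalan_div` (rates, PROVED), the enclosures of `CatalanFamily`. -/
theorem record_unconditional :
    ∃ e : ℕ → ℕ, ∃ P Qz : ℕ → ℤ,
      (∀ n : ℕ, (Qz n : ℝ) = 2 ^ (4 * n + e n) * (Nat.lcmUpto (2 * n - 1) : ℝ) ^ 2 * (u n : ℝ)
          ∧ (P n : ℝ) = 2 ^ (4 * n + e n) * (Nat.lcmUpto (2 * n - 1) : ℝ) ^ 2 * (v n : ℝ))
        ∧ Tendsto (fun n : ℕ => Real.log (Qz n : ℝ) / n) atTop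
            (𝓝 (4 * Real.log 2 + 4 + Real.log (((1 + Real.sqrt 5) / 2) ^ 5)))
        ∧ ∀ᶠ n : ℕ in atTop,
            0 < |catalanConstant - (P n : ℝ) / (Qz n : ℝ)|
              ∧ |catalanConstant - (P n : ℝ) / (Qz n : ℝ)| < |(Qz n : ℝ)| ^ (-(0.5242 : ℝ)) := by
  classical
  obtain ⟨e, hincl, hlim⟩ := remarksTheorem1.tendsto_log_denom remarksTheorem1_holds
  -- the integer sequences
  have hq : ∀ n : ℕ, ∃ z : ℤ, (z : ℚ) = 2 ^ (4 * n + e n) * (Nat.lcmUpto (2 * n - 1) : ℚ) ^ 2 * u n := by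
    intro n
    obtain ⟨⟨zu, hzu⟩, -⟩ := hincl n
    refine ⟨zu * (Nat.lcmUpto (2 * n - 1) : ℤ) ^ 2, ?_⟩
    push_cast
    rw [hzu]
    ring
  choose Qz hQz using hq
  choose P hP using fun n => (hincl n).2
  have hQR : ∀ n : ℕ, (Qz n : ℝ) = 2 ^ (4 * n + e n) * (Nat.lcmUpto (2 * n - 1) : ℝ) ^ 2 * (u n : ℝ) := by
    intro n
    have h' : ((Qz n : ℚ) : ℝ) = ((2 ^ (4 * n + e n) * (Nat.lcmUpto (2 * n - 1) : ℚ) ^ 2 * u n : ℚ) : ℝ) := by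
      rw [hQz n]
    push_cast at h'
    exact h'
  have hPR : ∀ n : ℕ, (P n : ℝ) = 2 ^ (4 * n + e n) * (Nat.lcmUpto (2 * n - 1) : ℝ) ^ 2 * (v n : ℝ) := by
    intro n
    have h' : ((P n : ℚ) : ℝ) = ((2 ^ (4 * n + e n) * (Nat.lcmUpto (2 * n - 1) : ℚ) ^ 2 * v n : ℚ) : ℝ) := by
      rw [hP n]
    push_cast at h'
    exact h'
  have hQpos : ∀ n : ℕ, (0 : ℝ) < (Qz n : ℝ) := by
    intro n
    rw [hQR n]
    have hd : (0 : ℝ) < (Nat.lcmUpto (2 * n - 1) : ℝ) := by exact_mod_cast Nat.lcmUpto_pos _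
    have hu : (0 : ℝ) < (u n : ℝ) := uR_pos n
    positivity
  -- the exponential type of `Q_n`
  set X : ℝ := Real.log (((1 + Real.sqrt 5) / 2) ^ 5) with hX
  have hlogQ : Tendsto (fun n : ℕ => Real.log (Qz n : ℝ) / n) atTop (𝓝 (4 * Real.log 2 + 4 + X)) := by
    have hsum := hlim.add tendsto_log_u_div
    refine hsum.congr' ?_
    filter_upwards [eventually_ge_atTop 1] with n hn
    have hd : (0 : ℝ) < (Nat.lcmUpto (2 * n - 1) : ℝ) := by exact_mod_cast Nat.lcmUpto_pos _
    have hu : (0 : ℝ) < (u n : ℝ) := uR_pos n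
    have h2 : (0 : ℝ) < (2 : ℝ) ^ (4 * n + e n) * (Nat.lcmUpto (2 * n - 1) : ℝ) ^ 2 := by positivity
    rw [hQR n, Real.log_mul h2.ne' hu.ne']
    show Real.log (2 ^ (4 * n + e n) * (Nat.lcmUpto (2 * n - 1) : ℝ) ^ 2) / n + Real.log (uR n) / n = _
    rw [uR, add_div]
  refine ⟨e, P, Qz, fun n => ⟨hQR n, hPR n⟩, hlogQ, ?_⟩
  -- the combined log-rate tends to a NEGATIVE limit
  have hrate : Tendsto (fun n : ℕ => Real.log |catalanConstant - vR n / uR n| / n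
      + (0.5242 : ℝ) * (Real.log (Qz n : ℝ) / n)) atTop (𝓝 (-2 * X + 0.5242 * (4 * Real.log 2 + 4 + X))) :=
    tendsto_log_abs_sub_catalan_div.add (hlogQ.const_mul _)
  have hneg : -2 * X + 0.5242 * (4 * Real.log 2 + 4 + X) < 0 := by
    obtain ⟨-, hl2⟩ := CatalanFamily.log_golden_inv_bounds
    have hX' : (2406 / 1000 : ℝ) < X := by rw [hX, log_golden_fifth_eq]; linarith
    have hlog2 := Real.log_two_lt_d9
    nlinarith
  have hev := hrate.eventually (gt_mem_nhds hneg)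
  filter_upwards [hev, eventually_ge_atTop 1] with n hn hn1
  have hu : (0 : ℝ) < (u n : ℝ) := uR_pos n
  have hQ := hQpos n
  have hratio : (P n : ℝ) / (Qz n : ℝ) = (v n : ℝ) / (u n : ℝ) := by
    rw [hQR n, hPR n]
    have hd : (0 : ℝ) < (Nat.lcmUpto (2 * n - 1) : ℝ) := by exact_mod_cast Nat.lcmUpto_pos _
    field_simp
  rw [hratio, abs_of_pos hQ]
  have hne : catalanConstant - (v n : ℝ) / (u n : ℝ) ≠ 0 := by
    intro h0
    apply form_ne_zero n
    unfold form
    have : catalanConstant = (v n : ℝ) / (u n : ℝ) := sub_eq_zero.mp h0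
    rw [this, mul_div_assoc', mul_div_cancel_left₀ _ hu.ne', sub_self]
  have habs : 0 < |catalanConstant - (v n : ℝ) / (u n : ℝ)| := abs_pos.mpr hne
  refine ⟨habs, ?_⟩
  have hnpos : (0 : ℝ) < n := by exact_mod_cast (show 0 < n by omega)
  have h1 : Real.log |catalanConstant - vR n / uR n| + 0.5242 * Real.log (Qz n : ℝ) < 0 := by
    have := mul_neg_of_pos_of_neg hnpos hn
    have e' : (n : ℝ) * (Real.log |catalanConstant - vR n / uR n| / n + 0.5242 * (Real.log (Qz n : ℝ) / n))
        = Real.log |catalanConstant - vR n / uR n| + 0.5242 * Real.log (Qz n : ℝ) := by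
      field_simp
    linarith [e' ▸ this]
  have h2 : Real.log |catalanConstant - (v n : ℝ) / (u n : ℝ)| < Real.log ((Qz n : ℝ) ^ (-(0.5242 : ℝ))) := by
    rw [Real.log_rpow hQ]
    have : vR n / uR n = (v n : ℝ) / (u n : ℝ) := rfl
    rw [this] at h1
    linarith
  exact (Real.log_lt_log_iff habs (Real.rpow_pos_of_pos hQ _)).mp h2

/-- **Corollary (the NEAR-MISSES form of row G, UNCONDITIONAL):** there are integer sequences `p_n, q_n` with,
eventually, `G ≠ p_n/q_n` and `|G − p_n/q_n| < |q_n|^{−0.5242}` — the conclusion `Nesterenko2016.theorem_main.eventually_ne`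
draws from the CITED theorem, here obtained from tree theorems only (Zudilin's sequence with the denominators of
[Zudilin2002CatalanRemarks, Theorem 1]).  An exponent `< 1`: nothing about irrationality. -/
theorem eventually_ne_unconditional :
    ∃ p q : ℕ → ℤ, ∀ᶠ n : ℕ in atTop,
      catalanConstant ≠ p n / q n ∧ |catalanConstant - p n / q n| < (|(q n : ℝ)|) ^ (-(0.5242 : ℝ)) := by
  obtain ⟨-, P, Qz, -, -, hev⟩ := record_unconditional
  refine ⟨P, Qz, hev.mono fun n hn => ⟨?_, hn.2⟩⟩
  intro heq
  have h := hn.1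
  rw [heq, sub_self, abs_zero] at h
  exact lt_irrefl _ h

end CatalanRecord

end Summit.KontsevichZagierPeriods.Zeta5Search
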